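import Literature.Dynamics.Contraction.BirkhoffContractionCrossRatio
import HarnessLib

/-!
# Hilbert's projective metric on the positive orthant and the Birkhoff–Hopf theorem for positive matrices
# (Eveson–Nussbaum 1995 Def 2.6, (7), Thm 3.5, Thm 6.2; Bapat–Raghavan 1997 §6.3; Lemmens–Nussbaum 2014 Thm 2.9)

Topic `Literature/Dynamics/Contraction`.  Companion of `BirkhoffContractionCrossRatio.lean` (Birkhoff's two-row inequality
in cross-ratio form, no vocabulary); this file supplies the VOCABULARY and the MATRIX statements as printed.
Mathlib has neither (`lean search 'hilbertDist|projectiveMetric|Birkhoff.*contraction'`, 2026-08-28: nothing); the tree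
has Dubois' complex gauge `duboisDelta` (`ComplexConeContraction.lean`, EReal-valued, complex cones) only.

DEFINITIONS (two, both with bodies).
* `hilbertDist x y = log ((⨆ i, x i ∕ y i) · (⨆ i, y i ∕ x i))` — Hilbert's projective metric on the interior of the cone
  of non-negative vectors of `ι → ℝ`, `ι` a finite type: for `x, y > 0` this is `log (M(x∕y)∕m(x∕y))` with
  `M(x∕y) = max_i x_i∕y_i`, `m(x∕y) = min_i x_i∕y_i` [EvesonNussbaum1995, Def 2.3 p. 33, Def 2.6 p. 34, and the display
  after Remark 2.5 p. 34 (the case `C(S) = ℝⁿ`)] `= log max_{i,j} (x_i y_j)∕(x_j y_i)` [ibid., (7) p. 52];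
  `θ(x, y) = log {sup(x∕y) · sup(y∕x)}` verbatim in [BapatRaghavan1997, Thm 6.3.6].  The formula is the one the tree's
  SAW sketch `Summits/CriticalPhenomena/SAWScalingLimit/Cruxes/BoundaryClosureR/CruxplanBirkhoffSketch.lean` wrote for its
  wanted fact `BirkhoffHopfContraction` (same body, so that fact is `hilbertDist_mulVec_le_and_le_tanh_mul` below by `exact`).
  Junk: for vectors with non-positive entries the value is whatever `Real.log`/`iSup` return; every lemma assumes positivity.
* `crossRatioDiam K = ⨆ ((i,i'),(j,j')), log (K i j · K i' j' ∕ (K i j' · K i' j))` — for an entrywise positive matrix this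
  is its PROJECTIVE DIAMETER `Δ(K) = sup d(Kx, Ky) = max_{j,j'} d(Ke_j, Ke_{j'}) = log max (K_{pi}K_{qj})∕(K_{pj}K_{qi})`
  [EvesonNussbaum1995, Def 3.3 p. 38 and Thm 6.2 (8)–(9) p. 52; BapatRaghavan1997, Lemma 6.3.8; LemmensNussbaum2014, display
  after Thm 2.9] — the two printed equalities are `crossRatioDiam_eq_ciSup_hilbertDist_col` ((8) = (9)) and
  `hilbertDist_mulVec_le_crossRatioDiam` + `hilbertDist_col_le_crossRatioDiam` (the sup over images is attained at columns).

THEOREMS (all proved; `x, y, u, v` positive vectors, `K` an `m × n` real matrix, finite nonempty index types).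
* metric API [EvesonNussbaum1995, Lemma 2.7 p. 34; BapatRaghavan1997, Thm 6.3.6, Lemma 6.3.7]: `hilbertDist_nonneg`, `_comm`,
  `_self`, `_smul_left/_right`, `_triangle`, `hilbertDist_eq_zero_iff` (`= 0 ↔ x = c • y`, `c > 0`); the cross-ratio
  dictionary `mul_mul_le_exp_hilbertDist` (`x_k y_l ≤ e^{d(x,y)} x_l y_k`), `hilbertDist_le_of_forall_mul_mul_le`,
  `hilbertDist_le_iff`.
* `hilbertDist_mulVec_le` — WEAK CONTRACTION: an entrywise non-negative `K` with `Ku, Kv > 0` has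
  `d(Ku, Kv) ≤ d(u, v)` [EvesonNussbaum1995, Lemma 3.1 (4) p. 37; BapatRaghavan1997, Lemma 6.3.10].
* `hilbertDist_mulVec_le_diam` — DIAMETER: rows with cross-ratios `≤ e^Δ` map any two non-negative vectors with positive
  images to distance `≤ Δ` [EvesonNussbaum1995, Thm 6.2 p. 52; BapatRaghavan1997, Lemma 6.3.8].
* `hilbertDist_mulVec_le_tanh_mul` — BIRKHOFF–HOPF: entrywise positive `K` with cross-ratios `≤ e^Δ` ⇒
  `d(Ku, Kv) ≤ tanh(Δ∕4) · d(u, v)` [Birkhoff1957; EvesonNussbaum1995, Thm 3.5 p. 39; BapatRaghavan1997, Thms 6.3.11–6.3.12;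
  LemmensNussbaum2014, Thm 2.9]; `hilbertDist_mulVec_le_and_le_tanh_mul` (the SAW sketch's shape, `Fin m`, `Fin n`);
  `hilbertDist_pow_mulVec_le` (square `K`: `d(Kᵏu, Kᵏv) ≤ tanh(Δ∕4)ᵏ · d(u, v)` [LemmensNussbaum2014, Thm 2.11]).
* the same with `Δ := crossRatioDiam K` (`…_crossRatioDiam` variants), `crossRatioDiam_nonneg`, `crossRatioDiam_le_of_forall`.

NOT HERE: general cones / infinite dimensions (E–N Thms 3.5–3.6 in full), the equality `k(L) = tanh(Δ∕4)` (sharpness —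
E–N §5; the `2 × 2` witness is the Summits helper `…N19BirkhoffContractionSharp`), Hopf's oscillation ratio and the
spectral consequences (Perron vector, `|λ₂| ≤ tanh(Δ∕4)·ρ(K)` — companion `HopfOscillationSpectralRatio.lean`), integral
operators (E–N Thm 6.3).  HONEST FRAMING: textbook material; nothing here concerns any summit.  No `instance`, no `sorry`.

## References
* [EvesonNussbaum1995] S. P. Eveson, R. D. Nussbaum, Math. Proc. Camb. Phil. Soc. 117 (1995) 31–55 — Def 2.3, Def 2.6,
  Lemma 2.7 (pp. 33–34), Lemma 3.1 (p. 37), Def 3.3 (p. 38), Thm 3.5 (p. 39), Thm 6.2 (7)–(9) (p. 52).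
* [BapatRaghavan1997] R. B. Bapat, T. E. S. Raghavan, *Nonnegative matrices and applications*, CUP 1997, §6.3: Thm 6.3.6,
  Lemmas 6.3.7, 6.3.8, 6.3.10, Thms 6.3.11, 6.3.12.
* [LemmensNussbaum2014] B. Lemmens, R. D. Nussbaum, Handbook of Hilbert Geometry (EMS 2014) 275–303 = arXiv:1304.7921, §2.1,
  Thm 2.9, Thm 2.11.
* [Birkhoff1957] G. Birkhoff, Trans. AMS 85 (1957) 219–227.
-/

noncomputable section

open Finset Real Matrix

namespace Literature.Dynamics.Contraction

/-! ## §1 Hilbert's projective metric on positive vectors over a finite index type -/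

section Metric

variable {ι : Type*}

/-- **Hilbert's projective metric** (Cayley–Hilbert metric) between two vectors of the open positive orthant of `ι → ℝ`,
`ι` finite: `d(x, y) = log ( max_i (x_i∕y_i) · max_i (y_i∕x_i) ) = log (M(x∕y)∕m(x∕y)) = log max_{i,j} (x_i y_j)∕(x_j y_i)`.
A pseudo-metric: `d(x, y) = 0` iff `x = c • y` for some `c > 0`.  Meaningful for entrywise positive `x, y` only (junk
otherwise). [cite: EvesonNussbaum1995, Def 2.6 p. 34 and eq. (7) p. 52; BapatRaghavan1997, Thm 6.3.6] -/
def hilbertDist (x y : ι → ℝ) : ℝ :=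
  Real.log ((⨆ i, x i / y i) * (⨆ i, y i / x i))

/-- Unfolding lemma. [cite: EvesonNussbaum1995, Def 2.6 p. 34] -/
theorem hilbertDist_def (x y : ι → ℝ) : hilbertDist x y = Real.log ((⨆ i, x i / y i) * (⨆ i, y i / x i)) := rfl

/-- Symmetry `d(x, y) = d(y, x)`. [cite: EvesonNussbaum1995, Lemma 2.7 p. 34; BapatRaghavan1997, Thm 6.3.6 (i)] -/
theorem hilbertDist_comm (x y : ι → ℝ) : hilbertDist x y = hilbertDist y x := by
  rw [hilbertDist, hilbertDist, mul_comm]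

variable [Finite ι]

/-- `x_k ∕ y_k ≤ M(x∕y) = max_i x_i∕y_i`. [cite: EvesonNussbaum1995, Def 2.3 p. 33] -/
theorem div_le_ciSup_div (x y : ι → ℝ) (k : ι) : x k / y k ≤ ⨆ i, x i / y i :=
  Finite.le_ciSup (fun i => x i / y i) k

variable [Nonempty ι] {x y z : ι → ℝ}

/-- `M(x∕y) > 0` for positive vectors. [cite: EvesonNussbaum1995, Def 2.6 p. 34 (`0 < m(x∕y) ≤ M(x∕y)`)] -/
theorem ciSup_div_pos (hx : ∀ i, 0 < x i) (hy : ∀ i, 0 < y i) : 0 < ⨆ i, x i / y i :=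
  let k := Classical.arbitrary ι
  lt_of_lt_of_le (div_pos (hx k) (hy k)) (div_le_ciSup_div x y k)

/-- `e^{d(x,y)} = M(x∕y) · M(y∕x)` for positive vectors. [cite: EvesonNussbaum1995, Def 2.6 p. 34] -/
theorem exp_hilbertDist (hx : ∀ i, 0 < x i) (hy : ∀ i, 0 < y i) :
    exp (hilbertDist x y) = (⨆ i, x i / y i) * (⨆ i, y i / x i) := by
  rw [hilbertDist, exp_log (mul_pos (ciSup_div_pos hx hy) (ciSup_div_pos hy hx))]

/-- THE CROSS-RATIO DICTIONARY (first half): every cross-ratio is bounded by `e^{d}`,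
`x_k y_l ≤ e^{d(x,y)} · x_l y_k`. [cite: EvesonNussbaum1995, eq. (7) p. 52] -/
theorem mul_mul_le_exp_hilbertDist (hx : ∀ i, 0 < x i) (hy : ∀ i, 0 < y i) (k l : ι) :
    x k * y l ≤ exp (hilbertDist x y) * (x l * y k) := by
  rw [exp_hilbertDist hx hy]
  have h1 : x k / y k ≤ ⨆ i, x i / y i := div_le_ciSup_div x y k
  have h2 : y l / x l ≤ ⨆ i, y i / x i := div_le_ciSup_div y x l
  have hA : 0 ≤ ⨆ i, x i / y i := (ciSup_div_pos hx hy).le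
  have h12 : x k / y k * (y l / x l) ≤ (⨆ i, x i / y i) * ⨆ i, y i / x i :=
    mul_le_mul h1 h2 (div_pos (hy l) (hx l)).le hA
  have hykxl : 0 < x l * y k := mul_pos (hx l) (hy k)
  have hyk : y k ≠ 0 := (hy k).ne'
  have hxl : x l ≠ 0 := (hx l).ne'
  calc x k * y l = x k / y k * (y l / x l) * (x l * y k) := by
        field_simp
    _ ≤ (⨆ i, x i / y i) * (⨆ i, y i / x i) * (x l * y k) := mul_le_mul_of_nonneg_right h12 hykxl.le

/-- THE CROSS-RATIO DICTIONARY (second half): a uniform cross-ratio bound `x_k y_l ≤ e^d · x_l y_k` gives `d(x, y) ≤ d`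
(the maxima are attained on the finite index type). [cite: EvesonNussbaum1995, eq. (7) p. 52] -/
theorem hilbertDist_le_of_forall_mul_mul_le (hx : ∀ i, 0 < x i) (hy : ∀ i, 0 < y i) {d : ℝ}
    (h : ∀ k l, x k * y l ≤ exp d * (x l * y k)) : hilbertDist x y ≤ d := by
  obtain ⟨k, hk⟩ := exists_eq_ciSup_of_finite (f := fun i => x i / y i)
  obtain ⟨l, hl⟩ := exists_eq_ciSup_of_finite (f := fun i => y i / x i)
  have hprod : (⨆ i, x i / y i) * (⨆ i, y i / x i) ≤ exp d := by
    rw [← hk, ← hl]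
    have hden : 0 < x l * y k := mul_pos (hx l) (hy k)
    rw [div_mul_div_comm, div_le_iff₀ (by rw [mul_comm]; exact hden)]
    calc x k * y l ≤ exp d * (x l * y k) := h k l
      _ = exp d * (y k * x l) := by ring
  calc hilbertDist x y = Real.log ((⨆ i, x i / y i) * (⨆ i, y i / x i)) := rfl
    _ ≤ Real.log (exp d) := log_le_log (mul_pos (ciSup_div_pos hx hy) (ciSup_div_pos hy hx)) hprod
    _ = d := log_exp d

/-- `d(x, y) ≤ d` iff all cross-ratios are `≤ e^d`. [cite: EvesonNussbaum1995, eq. (7) p. 52] -/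
theorem hilbertDist_le_iff (hx : ∀ i, 0 < x i) (hy : ∀ i, 0 < y i) {d : ℝ} :
    hilbertDist x y ≤ d ↔ ∀ k l, x k * y l ≤ exp d * (x l * y k) :=
  ⟨fun hd k l => (mul_mul_le_exp_hilbertDist hx hy k l).trans
      (mul_le_mul_of_nonneg_right (exp_le_exp.2 hd) (mul_pos (hx l) (hy k)).le),
    hilbertDist_le_of_forall_mul_mul_le hx hy⟩

/-- `0 ≤ d(x, y)`. [cite: EvesonNussbaum1995, Def 2.6 p. 34 (`m ≤ M`); BapatRaghavan1997, Thm 6.3.6] -/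
theorem hilbertDist_nonneg (hx : ∀ i, 0 < x i) (hy : ∀ i, 0 < y i) : 0 ≤ hilbertDist x y := by
  have k := Classical.arbitrary ι
  have h := mul_mul_le_exp_hilbertDist hx hy k k
  have hpos : 0 < x k * y k := mul_pos (hx k) (hy k)
  have h1 : 1 ≤ exp (hilbertDist x y) := le_of_mul_le_mul_right (by simpa [mul_comm] using h) hpos
  exact one_le_exp_iff.1 h1

/-- `d(x, x) = 0`. [cite: EvesonNussbaum1995, Lemma 2.7 p. 34 (`d(x, λx) = 0`)] -/
theorem hilbertDist_self (hx : ∀ i, 0 < x i) : hilbertDist x x = 0 :=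
  le_antisymm (hilbertDist_le_of_forall_mul_mul_le hx hx fun k l => by rw [exp_zero, one_mul, mul_comm])
    (hilbertDist_nonneg hx hx)

/-- Projective invariance in the first argument: `d(c • x, y) = d(x, y)` for `c > 0`.
[cite: EvesonNussbaum1995, Lemma 2.7 p. 34; BapatRaghavan1997, Lemma 6.3.7] -/
theorem hilbertDist_smul_left (hx : ∀ i, 0 < x i) (hy : ∀ i, 0 < y i) {c : ℝ} (hc : 0 < c) :
    hilbertDist (c • x) y = hilbertDist x y := by
  have hcx : ∀ i, 0 < (c • x) i := fun i => by simpa using mul_pos hc (hx i)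
  refine le_antisymm ?_ ?_
  · refine hilbertDist_le_of_forall_mul_mul_le hcx hy fun k l => ?_
    have h := mul_mul_le_exp_hilbertDist hx hy k l
    simp only [Pi.smul_apply, smul_eq_mul]
    calc c * x k * y l = c * (x k * y l) := by ring
      _ ≤ c * (exp (hilbertDist x y) * (x l * y k)) := mul_le_mul_of_nonneg_left h hc.le
      _ = exp (hilbertDist x y) * (c * x l * y k) := by ring
  · refine hilbertDist_le_of_forall_mul_mul_le hx hy fun k l => ?_
    have h := mul_mul_le_exp_hilbertDist hcx hy k l
    simp only [Pi.smul_apply, smul_eq_mul] at h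
    have h' : c * (x k * y l) ≤ c * (exp (hilbertDist (c • x) y) * (x l * y k)) := by
      calc c * (x k * y l) = c * x k * y l := by ring
        _ ≤ exp (hilbertDist (c • x) y) * (c * x l * y k) := h
        _ = c * (exp (hilbertDist (c • x) y) * (x l * y k)) := by ring
    exact le_of_mul_le_mul_left h' hc

/-- Projective invariance in the second argument: `d(x, c • y) = d(x, y)` for `c > 0`.
[cite: EvesonNussbaum1995, Lemma 2.7 p. 34; BapatRaghavan1997, Lemma 6.3.7] -/
theorem hilbertDist_smul_right (hx : ∀ i, 0 < x i) (hy : ∀ i, 0 < y i) {c : ℝ} (hc : 0 < c) :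
    hilbertDist x (c • y) = hilbertDist x y := by
  rw [hilbertDist_comm, hilbertDist_smul_left hy hx hc, hilbertDist_comm]

/-- Triangle inequality `d(x, z) ≤ d(x, y) + d(y, z)` (multiply the two cross-ratio bounds).
[cite: EvesonNussbaum1995, Lemma 2.7 p. 34; BapatRaghavan1997, Thm 6.3.6 (iii)] -/
theorem hilbertDist_triangle (hx : ∀ i, 0 < x i) (hy : ∀ i, 0 < y i) (hz : ∀ i, 0 < z i) :
    hilbertDist x z ≤ hilbertDist x y + hilbertDist y z := by
  refine hilbertDist_le_of_forall_mul_mul_le hx hz fun k l => ?_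
  have h1 := mul_mul_le_exp_hilbertDist hx hy k l
  have h2 := mul_mul_le_exp_hilbertDist hy hz k l
  have hyy : 0 < y k * y l := mul_pos (hy k) (hy l)
  have key : (x k * z l) * (y k * y l) ≤ (exp (hilbertDist x y + hilbertDist y z) * (x l * z k)) * (y k * y l) := by
    calc (x k * z l) * (y k * y l) = (x k * y l) * (y k * z l) := by ring
      _ ≤ (exp (hilbertDist x y) * (x l * y k)) * (exp (hilbertDist y z) * (y l * z k)) :=
          mul_le_mul h1 h2 (mul_pos (hy k) (hz l)).le (mul_nonneg (exp_pos _).le (mul_pos (hx l) (hy k)).le)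
      _ = (exp (hilbertDist x y + hilbertDist y z) * (x l * z k)) * (y k * y l) := by rw [exp_add]; ring
  exact le_of_mul_le_mul_right key hyy

/-- `d(x, y) = 0` iff `x = c • y` for some `c > 0` (the pseudo-metric identifies exactly the rays).
[cite: BapatRaghavan1997, Thm 6.3.6 (ii); EvesonNussbaum1995, Lemma 2.7 p. 34] -/
theorem hilbertDist_eq_zero_iff (hx : ∀ i, 0 < x i) (hy : ∀ i, 0 < y i) :
    hilbertDist x y = 0 ↔ ∃ c : ℝ, 0 < c ∧ x = c • y := by
  constructor
  · intro h0
    have hle : ∀ k l, x k * y l ≤ x l * y k := fun k l => by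
      simpa [h0] using mul_mul_le_exp_hilbertDist hx hy k l
    have heq : ∀ k l, x k * y l = x l * y k := fun k l => le_antisymm (hle k l) (hle l k)
    let k₀ := Classical.arbitrary ι
    refine ⟨x k₀ / y k₀, div_pos (hx k₀) (hy k₀), funext fun i => ?_⟩
    simp only [Pi.smul_apply, smul_eq_mul]
    rw [div_mul_eq_mul_div, eq_div_iff (hy k₀).ne']
    exact heq i k₀
  · rintro ⟨c, hc, rfl⟩
    rw [hilbertDist_smul_left hy hy hc, hilbertDist_self hy]

end Metric

/-! ## §2 Positive matrices: weak contraction, the diameter bound, Birkhoff's contraction -/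

section Matrices

variable {m n : Type*}

/-- `(K *ᵥ u) i = Σ_j K i j · u j`. [cite: BapatRaghavan1997, §6.3 (proof of Lemma 6.3.8)] -/
theorem mulVec_apply_eq_sum [Fintype n] (K : Matrix m n ℝ) (u : n → ℝ) (i : m) : (K *ᵥ u) i = ∑ j, K i j * u j := rfl

/-- An entrywise positive matrix maps positive vectors to positive vectors ("`A` maps all nonzero vectors of `K_n` into the
interior of `K_m`"). [cite: BapatRaghavan1997, §6.3 (paragraph before Lemma 6.3.8)] -/
theorem mulVec_pos [Fintype n] [Nonempty n] {K : Matrix m n ℝ} (hK : ∀ i j, 0 < K i j) {u : n → ℝ} (hu : ∀ j, 0 < u j) (i : m) :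
    0 < (K *ᵥ u) i := by
  rw [mulVec_apply_eq_sum]
  exact sum_pos (fun j _ => mul_pos (hK i j) (hu j)) univ_nonempty

/-- The same for a non-negative, non-zero vector. [cite: BapatRaghavan1997, §6.3 (paragraph before Lemma 6.3.8)] -/
theorem mulVec_pos_of_ne_zero [Fintype n] {K : Matrix m n ℝ} (hK : ∀ i j, 0 < K i j) {u : n → ℝ} (hu : ∀ j, 0 ≤ u j)
    (hu0 : u ≠ 0) (i : m) : 0 < (K *ᵥ u) i := by
  obtain ⟨j, hj⟩ := Function.ne_iff.1 hu0
  have hj' : u j ≠ 0 := by simpa using hj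
  rw [mulVec_apply_eq_sum]
  exact sum_pos' (fun l _ => mul_nonneg (hK i l).le (hu l)) ⟨j, mem_univ j, mul_pos (hK i j) ((hu j).lt_of_ne' hj')⟩

/-- **WEAK CONTRACTION**: an entrywise non-negative matrix never expands Hilbert's metric on vectors with positive images,
`d(Ku, Kv) ≤ d(u, v)`. [cite: EvesonNussbaum1995, Lemma 3.1 (4) p. 37; BapatRaghavan1997, Lemma 6.3.10] -/
theorem hilbertDist_mulVec_le [Fintype n] [Nonempty n] [Finite m] [Nonempty m] {K : Matrix m n ℝ} (hK : ∀ i j, 0 ≤ K i j) {u v : n → ℝ}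
    (hu : ∀ j, 0 < u j) (hv : ∀ j, 0 < v j) (hKu : ∀ i, 0 < (K *ᵥ u) i) (hKv : ∀ i, 0 < (K *ᵥ v) i) :
    hilbertDist (K *ᵥ u) (K *ᵥ v) ≤ hilbertDist u v := by
  refine hilbertDist_le_of_forall_mul_mul_le hKu hKv fun i i' => ?_
  have h := BirkhoffHopf.two_rows_le_exp_dist (s := univ) (a := fun j => K i j) (b := fun j => K i' j) (x := v) (y := u)
    (d := hilbertDist u v) (fun j _ => hK i j) (fun j _ => hK i' j)
    (fun k _ l _ => by simpa [mul_comm] using mul_mul_le_exp_hilbertDist hu hv k l)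
  simpa [mulVec_apply_eq_sum, mul_comm] using h

/-- **THE DIAMETER BOUND**: if the rows of `K` have cross-ratios `≤ e^Δ` (`K i j · K i' j' ≤ e^Δ · K i j' · K i' j`), the
images of any two non-negative vectors with positive images are at Hilbert distance `≤ Δ` — the projective diameter of
`K(ℝⁿ₊)` is at most (in fact exactly, `crossRatioDiam_eq_ciSup_hilbertDist_col`) the columns' cross-ratio bound.
[cite: EvesonNussbaum1995, Thm 6.2 (8)–(9) p. 52; BapatRaghavan1997, Lemma 6.3.8] -/
theorem hilbertDist_mulVec_le_diam [Fintype n] [Finite m] [Nonempty m] {K : Matrix m n ℝ} {Δ : ℝ}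
    (hΔ : ∀ i i' j j', K i j * K i' j' ≤ exp Δ * (K i j' * K i' j)) {u v : n → ℝ} (hu : ∀ j, 0 ≤ u j) (hv : ∀ j, 0 ≤ v j)
    (hKu : ∀ i, 0 < (K *ᵥ u) i) (hKv : ∀ i, 0 < (K *ᵥ v) i) :
    hilbertDist (K *ᵥ u) (K *ᵥ v) ≤ Δ := by
  refine hilbertDist_le_of_forall_mul_mul_le hKu hKv fun i i' => ?_
  have h := BirkhoffHopf.two_rows_le_exp_diam (s := univ) (a := fun j => K i j) (b := fun j => K i' j) (x := v) (y := u)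
    (Δ := Δ) (fun j _ => hv j) (fun j _ => hu j) (fun k _ l _ => hΔ i i' k l)
  simpa [mulVec_apply_eq_sum, mul_comm] using h

/-- A cross-ratio bound on a matrix with a positive entry forces `0 ≤ Δ`. [cite: EvesonNussbaum1995, Def 3.3 p. 38 (`Δ(L) ≥ 0`)] -/
theorem diam_nonneg_of_crossRatio_le {K : Matrix m n ℝ} {Δ : ℝ} (i : m) (j : n) (hK : 0 < K i j)
    (hΔ : K i j * K i j ≤ exp Δ * (K i j * K i j)) : 0 ≤ Δ := by
  have : 1 ≤ exp Δ := by nlinarith [mul_pos hK hK]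
  exact one_le_exp_iff.1 this

/-- **BIRKHOFF–HOPF THEOREM FOR POSITIVE MATRICES**: an entrywise positive matrix whose `2 × 2` cross-ratios are `≤ e^Δ`
(projective diameter `≤ Δ`) contracts Hilbert's projective metric by Birkhoff's coefficient,
`d(Ku, Kv) ≤ tanh(Δ∕4) · d(u, v)`. [cite: EvesonNussbaum1995, Thm 3.5 p. 39 with Thm 6.2 p. 52;
BapatRaghavan1997, Thms 6.3.11–6.3.12; LemmensNussbaum2014, Thm 2.9; Birkhoff1957] -/
theorem hilbertDist_mulVec_le_tanh_mul [Fintype n] [Nonempty n] [Finite m] [Nonempty m] {K : Matrix m n ℝ}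
    (hK : ∀ i j, 0 < K i j) {Δ : ℝ}
    (hΔ : ∀ i i' j j', K i j * K i' j' ≤ exp Δ * (K i j' * K i' j)) {u v : n → ℝ} (hu : ∀ j, 0 < u j)
    (hv : ∀ j, 0 < v j) :
    hilbertDist (K *ᵥ u) (K *ᵥ v) ≤ Real.tanh (Δ / 4) * hilbertDist u v := by
  have i₀ := Classical.arbitrary m
  have j₀ := Classical.arbitrary n
  have hΔ0 : 0 ≤ Δ := diam_nonneg_of_crossRatio_le i₀ j₀ (hK i₀ j₀) (hΔ i₀ i₀ j₀ j₀)
  have hKu := mulVec_pos hK hu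
  have hKv := mulVec_pos hK hv
  refine hilbertDist_le_of_forall_mul_mul_le hKu hKv fun i i' => ?_
  have h := BirkhoffHopf.two_rows_le_exp_tanh_mul (s := univ) (a := fun j => K i j) (b := fun j => K i' j) (x := v)
    (y := u) (d := hilbertDist u v) (Δ := Δ) (hilbertDist_nonneg hu hv) hΔ0 (fun j _ => hK i j) (fun j _ => hK i' j)
    (fun j _ => hv j) (fun j _ => hu j) (fun k _ l _ => by simpa [mul_comm] using mul_mul_le_exp_hilbertDist hu hv k l)
    (fun k _ l _ => hΔ i i' k l)
  simpa [mulVec_apply_eq_sum, mul_comm] using h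

/-- The Birkhoff–Hopf theorem in the shape of the tree's wanted fact `BirkhoffHopfContraction`
(`Summits/CriticalPhenomena/SAWScalingLimit/Cruxes/BoundaryClosureR/CruxplanBirkhoffSketch.lean`): a positive `m × n`
kernel with cross-ratios `≤ e^Δ` maps any two positive vectors to vectors at Hilbert distance `≤ Δ`, and contracts the
Hilbert distance by `tanh(Δ∕4)`. [cite: EvesonNussbaum1995, Thm 3.5 p. 39 and Thm 6.2 p. 52;
LemmensNussbaum2014, Thm 2.9; Birkhoff1957] -/
theorem hilbertDist_mulVec_le_and_le_tanh_mul (m n : ℕ) (K : Matrix (Fin m) (Fin n) ℝ) (Δ : ℝ) (hm : 0 < m)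
    (hn : 0 < n) (hK : ∀ i j, 0 < K i j) (hΔ : ∀ i i' j j', K i j * K i' j' ≤ Real.exp Δ * (K i j' * K i' j))
    (u v : Fin n → ℝ) (hu : ∀ j, 0 < u j) (hv : ∀ j, 0 < v j) :
    hilbertDist (K.mulVec u) (K.mulVec v) ≤ Δ ∧
      hilbertDist (K.mulVec u) (K.mulVec v) ≤ Real.tanh (Δ / 4) * hilbertDist u v := by
  haveI : Nonempty (Fin m) := ⟨⟨0, hm⟩⟩
  haveI : Nonempty (Fin n) := ⟨⟨0, hn⟩⟩
  exact ⟨hilbertDist_mulVec_le_diam hΔ (fun j => (hu j).le) (fun j => (hv j).le) (mulVec_pos hK hu) (mulVec_pos hK hv),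
    hilbertDist_mulVec_le_tanh_mul hK hΔ hu hv⟩

/-- Powers of an entrywise positive square matrix map positive vectors to positive vectors.
[cite: BapatRaghavan1997, §6.3 (paragraph before Lemma 6.3.8)] -/
theorem pow_mulVec_pos [Fintype m] [DecidableEq m] [Nonempty m] {K : Matrix m m ℝ} (hK : ∀ i j, 0 < K i j) {w : m → ℝ} (hw : ∀ j, 0 < w j) (k : ℕ) :
    ∀ j, 0 < ((K ^ k) *ᵥ w) j := by
  induction k with
  | zero => simpa using hw
  | succ k ih =>
    intro j
    rw [pow_succ', ← mulVec_mulVec]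
    exact mulVec_pos hK ih j

/-- Iteration for a square positive matrix: `d(Kᵏu, Kᵏv) ≤ tanh(Δ∕4)ᵏ · d(u, v)` — geometric convergence of all positive
rays to one another (to the Perron ray). [cite: LemmensNussbaum2014, Thm 2.11 (`d(L^{kp}x, v) ≤ c^k d(x, v)`);
BapatRaghavan1997, remark after Thm 6.3.12] -/
theorem hilbertDist_pow_mulVec_le [Fintype m] [DecidableEq m] [Nonempty m] {K : Matrix m m ℝ} (hK : ∀ i j, 0 < K i j) {Δ : ℝ}
    (hΔ : ∀ i i' j j', K i j * K i' j' ≤ exp Δ * (K i j' * K i' j)) {u v : m → ℝ} (hu : ∀ j, 0 < u j)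
    (hv : ∀ j, 0 < v j) (k : ℕ) :
    hilbertDist ((K ^ k) *ᵥ u) ((K ^ k) *ᵥ v) ≤ Real.tanh (Δ / 4) ^ k * hilbertDist u v := by
  induction k with
  | zero => simp
  | succ k ih =>
    have i₀ := Classical.arbitrary m
    have hτ : 0 ≤ Real.tanh (Δ / 4) :=
      BirkhoffHopf.tanh_quarter_nonneg (diam_nonneg_of_crossRatio_le i₀ i₀ (hK i₀ i₀) (hΔ i₀ i₀ i₀ i₀))
    rw [pow_succ', ← mulVec_mulVec, ← mulVec_mulVec]
    calc hilbertDist (K *ᵥ ((K ^ k) *ᵥ u)) (K *ᵥ ((K ^ k) *ᵥ v))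
        ≤ Real.tanh (Δ / 4) * hilbertDist ((K ^ k) *ᵥ u) ((K ^ k) *ᵥ v) :=
          hilbertDist_mulVec_le_tanh_mul hK hΔ (pow_mulVec_pos hK hu k) (pow_mulVec_pos hK hv k)
      _ ≤ Real.tanh (Δ / 4) * (Real.tanh (Δ / 4) ^ k * hilbertDist u v) := mul_le_mul_of_nonneg_left ih hτ
      _ = Real.tanh (Δ / 4) ^ (k + 1) * hilbertDist u v := by ring

end Matrices

/-! ## §3 The projective diameter of a positive matrix -/

section Diameter

variable {m n : Type*}

/-- The **cross-ratio (projective) diameter** of a matrix: `Δ(K) = log max_{i,i',j,j'} (K i j · K i' j')∕(K i j' · K i' j)`.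
For an entrywise positive `K` this is the Hilbert diameter of the image cone `K(ℝⁿ₊ ∖ 0)`, `= max_{j,j'} d(Ke_j, Ke_{j'})`
(`crossRatioDiam_eq_ciSup_hilbertDist_col`, `hilbertDist_mulVec_le_crossRatioDiam`).  Junk for matrices with a
non-positive entry. [cite: EvesonNussbaum1995, Def 3.3 p. 38 and Thm 6.2 (9) p. 52; BapatRaghavan1997, Lemma 6.3.8;
LemmensNussbaum2014, display after Thm 2.9] -/
def crossRatioDiam (K : Matrix m n ℝ) : ℝ :=
  ⨆ p : (m × m) × (n × n), Real.log (K p.1.1 p.2.1 * K p.1.2 p.2.2 / (K p.1.1 p.2.2 * K p.1.2 p.2.1))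

variable {K : Matrix m n ℝ}

/-- Every cross-ratio is bounded by `e^{Δ(K)}`. [cite: EvesonNussbaum1995, Thm 6.2 (9) p. 52; BapatRaghavan1997, Lemma 6.3.8] -/
theorem mul_mul_le_exp_crossRatioDiam [Finite m] [Finite n] (hK : ∀ i j, 0 < K i j) (i i' : m) (j j' : n) :
    K i j * K i' j' ≤ exp (crossRatioDiam K) * (K i j' * K i' j) := by
  have hden : 0 < K i j' * K i' j := mul_pos (hK i j') (hK i' j)
  have hle : Real.log (K i j * K i' j' / (K i j' * K i' j)) ≤ crossRatioDiam K :=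
    Finite.le_ciSup (fun p : (m × m) × (n × n) =>
      Real.log (K p.1.1 p.2.1 * K p.1.2 p.2.2 / (K p.1.1 p.2.2 * K p.1.2 p.2.1))) ((i, i'), (j, j'))
  have h := exp_le_exp.2 hle
  rw [exp_log (div_pos (mul_pos (hK i j) (hK i' j')) hden)] at h
  exact (div_le_iff₀ hden).1 h

/-- A uniform cross-ratio bound bounds the diameter: `Δ(K) ≤ Δ`. [cite: EvesonNussbaum1995, Thm 6.2 (9) p. 52] -/
theorem crossRatioDiam_le_of_forall [Nonempty m] [Nonempty n] (hK : ∀ i j, 0 < K i j) {Δ : ℝ}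
    (hΔ : ∀ i i' j j', K i j * K i' j' ≤ exp Δ * (K i j' * K i' j)) : crossRatioDiam K ≤ Δ := by
  refine ciSup_le fun p => ?_
  have hden : 0 < K p.1.1 p.2.2 * K p.1.2 p.2.1 := mul_pos (hK _ _) (hK _ _)
  rw [← log_exp Δ]
  exact log_le_log (div_pos (mul_pos (hK _ _) (hK _ _)) hden) ((div_le_iff₀ hden).2 (hΔ _ _ _ _))

/-- `0 ≤ Δ(K)`. [cite: EvesonNussbaum1995, Def 3.3 p. 38] -/
theorem crossRatioDiam_nonneg [Finite m] [Finite n] [Nonempty m] [Nonempty n] (hK : ∀ i j, 0 < K i j) : 0 ≤ crossRatioDiam K :=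
  let i := Classical.arbitrary m
  let j := Classical.arbitrary n
  diam_nonneg_of_crossRatio_le i j (hK i j) (mul_mul_le_exp_crossRatioDiam hK i i j j)

/-- Each pair of columns is at Hilbert distance `≤ Δ(K)`. [cite: EvesonNussbaum1995, Thm 6.2 (8) p. 52] -/
theorem hilbertDist_col_le_crossRatioDiam [Finite m] [Finite n] [Nonempty m] (hK : ∀ i j, 0 < K i j) (j j' : n) :
    hilbertDist (fun i => K i j) (fun i => K i j') ≤ crossRatioDiam K :=
  hilbertDist_le_of_forall_mul_mul_le (fun i => hK i j) (fun i => hK i j') fun i i' => by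
    simpa [mul_comm] using mul_mul_le_exp_crossRatioDiam hK i i' j j'

/-- **E–N (8) = (9)**: the cross-ratio diameter is the largest Hilbert distance between two columns,
`Δ(K) = max_{j,j'} d(Ke_j, Ke_{j'})`. [cite: EvesonNussbaum1995, Thm 6.2 (8)–(9) p. 52; LemmensNussbaum2014, display after Thm 2.9] -/
theorem crossRatioDiam_eq_ciSup_hilbertDist_col [Finite m] [Finite n] [Nonempty m] [Nonempty n] (hK : ∀ i j, 0 < K i j) :
    crossRatioDiam K = ⨆ q : n × n, hilbertDist (fun i => K i q.1) (fun i => K i q.2) := by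
  refine le_antisymm ?_ ?_
  · refine ciSup_le fun p => ?_
    have hcol := mul_mul_le_exp_hilbertDist (fun i => hK i p.2.1) (fun i => hK i p.2.2) p.1.1 p.1.2
    have hden : 0 < K p.1.1 p.2.2 * K p.1.2 p.2.1 := mul_pos (hK _ _) (hK _ _)
    have h1 : Real.log (K p.1.1 p.2.1 * K p.1.2 p.2.2 / (K p.1.1 p.2.2 * K p.1.2 p.2.1)) ≤
        hilbertDist (fun i => K i p.2.1) (fun i => K i p.2.2) := by
      rw [← log_exp (hilbertDist _ _)]
      refine log_le_log (div_pos (mul_pos (hK _ _) (hK _ _)) hden) ((div_le_iff₀ hden).2 ?_)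
      simpa [mul_comm] using hcol
    exact h1.trans (Finite.le_ciSup (fun q : n × n => hilbertDist (fun i => K i q.1) (fun i => K i q.2)) p.2)
  · exact ciSup_le fun q => hilbertDist_col_le_crossRatioDiam hK q.1 q.2

/-- The images of any two non-negative non-zero vectors are at distance `≤ Δ(K)` — so `Δ(K)` IS the projective diameter
of `K(ℝⁿ₊ ∖ 0)` (attained at columns by `crossRatioDiam_eq_ciSup_hilbertDist_col`).
[cite: EvesonNussbaum1995, Def 3.3 p. 38 and Thm 6.2 (8) p. 52; BapatRaghavan1997, Lemma 6.3.8] -/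
theorem hilbertDist_mulVec_le_crossRatioDiam [Finite m] [Nonempty m] [Fintype n] (hK : ∀ i j, 0 < K i j) {u v : n → ℝ} (hu : ∀ j, 0 ≤ u j)
    (hv : ∀ j, 0 ≤ v j) (hu0 : u ≠ 0) (hv0 : v ≠ 0) :
    hilbertDist (K *ᵥ u) (K *ᵥ v) ≤ crossRatioDiam K :=
  hilbertDist_mulVec_le_diam (mul_mul_le_exp_crossRatioDiam hK) hu hv (mulVec_pos_of_ne_zero hK hu hu0)
    (mulVec_pos_of_ne_zero hK hv hv0)

/-- Birkhoff–Hopf with the matrix's own diameter: `d(Ku, Kv) ≤ tanh(Δ(K)∕4) · d(u, v)`.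
[cite: EvesonNussbaum1995, Thm 3.5 p. 39 with Thm 6.2 p. 52; BapatRaghavan1997, Thms 6.3.11–6.3.12;
LemmensNussbaum2014, Thm 2.9; Birkhoff1957] -/
theorem hilbertDist_mulVec_le_tanh_crossRatioDiam_mul [Finite m] [Nonempty m] [Fintype n] [Nonempty n] (hK : ∀ i j, 0 < K i j) {u v : n → ℝ}
    (hu : ∀ j, 0 < u j) (hv : ∀ j, 0 < v j) :
    hilbertDist (K *ᵥ u) (K *ᵥ v) ≤ Real.tanh (crossRatioDiam K / 4) * hilbertDist u v :=
  hilbertDist_mulVec_le_tanh_mul hK (mul_mul_le_exp_crossRatioDiam hK) hu hv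

end Diameter

end Literature.Dynamics.Contraction

end
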